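import Summits.RiemannHypothesis.RiemannHypothesis.Theorems.WeilGroundStateGroundStatesConvergeToXiRenormBlowupPrelim
import HarnessLib

/-!
# `WeilGroundState.GroundStatesConvergeToXi` — the overlap with the window's kernel stays
non-degenerate when the renormalisation constants are bounded
(crux item stmt-RiemannHypothesis-1527, route route-RiemannHypothesis-WeilGroundState; line `Sketch`,
lead c3; `--supports`: core estimate of the renormalisation blow-up theorem `…RenormBlowup.lean`)

RH-free.  For ground states `u_k` at windows `a_k → ∞` and scalars `c_k` with
`c_k · weilMellin u_k → ξ` locally uniformly on the open strip (the convergence clause of the crux):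

* `overlap_eq_bulk_add_tail` — Parseval splitting `⟨u, φ_a⟩ = ∫_s 𝓕u·𝓕⁻φ_a + ∫_{sᶜ} 𝓕u·𝓕⁻φ_a`;
* `exists_norm_tail_fourier_overlap_le` — the frequency tail is small UNIFORMLY in the window:
  AM–GM + Plancherel `∫|𝓕u|² = ∫|u|² = 1` (window-independent) + the uniform `L²`-tail of `𝓕⁻φ_a`;
* `exists_norm_bulk_fourier_overlap_sub_le` — on a frequency window `[-R,R]`,
  `c·bulk ≈ ∫_{[-R,R]}|Ξ|²` as soon as `c𝓕u ≈ Ξ` there;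
* `exists_eventually_norm_overlap_ge` — **core estimate**: for every `M > 0` there is `L > 0` with
  `‖⟨u_k, φ_{a_k}⟩‖ ≥ L` for all large `k` such that `‖c_k‖ ≤ M`.
Also `η(a) = exp(−(π/4)e^{2(a−1)}) → 0` and `η(a)e^{3a/2} → 0`.  No new definitions.
-/

noncomputable section

set_option linter.dupNamespace false

open scoped Topology Real ComplexConjugate FourierTransform
open Filter Set MeasureTheory Complex

namespace Summit.RiemannHypothesis.RiemannHypothesis.Theorems.GroundStatesConvergeToXi

open Literature.NumberTheory.LFunctions

/-! ## `η(a) → 0` along the windows and the `L¹` bound on a window -/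

/-- `η(a) := exp(−(π/4)e^{2(a−1)}) → 0` and `η(a) e^{3a/2} → 0` as `a → ∞`. [folklore] -/
theorem tendsto_superexp_mul_exp_threeHalves_zero :
    Tendsto (fun a : ℝ => Real.exp (-(π / 4 * Real.exp (2 * (a - 1)))) * Real.exp (3 / 2 * a))
      atTop (𝓝 0) := by
  have h1 : Tendsto (fun a : ℝ => (π / 2 - 3 / 2) * a - π / 4) atTop atTop :=
    tendsto_atTop_add_const_right _ _ (tendsto_id.const_mul_atTop (by linarith [Real.pi_gt_three]))
  have h2 : Tendsto (fun a : ℝ => π / 4 * Real.exp (2 * (a - 1)) - 3 / 2 * a) atTop atTop := by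
    refine tendsto_atTop_mono (fun a => ?_) h1
    have := Real.add_one_le_exp (2 * (a - 1))
    nlinarith [Real.pi_gt_three]
  have h3 := Real.tendsto_exp_atBot.comp (tendsto_neg_atTop_atBot.comp h2)
  refine h3.congr fun a => ?_
  simp only [Function.comp_apply, ← Real.exp_add]
  congr 1
  ring

/-- `η(a) → 0` as `a → ∞`. [folklore] -/
theorem tendsto_superexp_zero :
    Tendsto (fun a : ℝ => Real.exp (-(π / 4 * Real.exp (2 * (a - 1))))) atTop (𝓝 0) := by
  refine tendsto_of_tendsto_of_tendsto_of_le_of_le' tendsto_const_nhds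
    tendsto_superexp_mul_exp_threeHalves_zero (Eventually.of_forall fun a => (Real.exp_pos _).le) ?_
  filter_upwards [eventually_ge_atTop (0 : ℝ)] with a ha
  exact le_mul_of_one_le_right (Real.exp_pos _).le (Real.one_le_exp (by positivity))

/-! ## The overlap through the critical line: splitting, tail and bulk -/

/-- **Parseval splitting of the overlap**: for a ground state `u` at the window `a`,
`⟨u, φ_a⟩ = ∫_s 𝓕u·𝓕⁻φ_a + ∫_{sᶜ} 𝓕u·𝓕⁻φ_a` for every measurable frequency set `s`
(`φ_a` is real, `∫ u φ_a = ∫ 𝓕u · 𝓕⁻φ_a`, and `𝓕u · 𝓕⁻φ_a ∈ L¹` since `𝓕u` is bounded and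
`𝓕⁻φ_a` is Schwartz). [folklore] -/
theorem overlap_eq_bulk_add_tail {a : ℝ} {u : ℝ → ℂ} (hu : IsWeilGroundState a u)
    {s : Set ℝ} (hs : MeasurableSet s) :
    Integrable (fun ξ : ℝ => 𝓕 u ξ * 𝓕⁻ (fun t : ℝ => (2 : ℂ) * LagariasMontague.Psic (2 * t) *
        ((Literature.Analysis.Calculus.cutoff a t : ℝ) : ℂ)) ξ) ∧
    (∫ t, u t * conj ((2 : ℂ) * LagariasMontague.Psic (2 * t) *
        ((Literature.Analysis.Calculus.cutoff a t : ℝ) : ℂ))) =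
      (∫ ξ in s, 𝓕 u ξ * 𝓕⁻ (fun t : ℝ => (2 : ℂ) * LagariasMontague.Psic (2 * t) *
        ((Literature.Analysis.Calculus.cutoff a t : ℝ) : ℂ)) ξ) +
      ∫ ξ in sᶜ, 𝓕 u ξ * 𝓕⁻ (fun t : ℝ => (2 : ℂ) * LagariasMontague.Psic (2 * t) *
        ((Literature.Analysis.Calculus.cutoff a t : ℝ) : ℂ)) ξ := by
  set φ : ℝ → ℂ := fun t : ℝ => (2 : ℂ) * LagariasMontague.Psic (2 * t) *
    ((Literature.Analysis.Calculus.cutoff a t : ℝ) : ℂ) with hφdef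
  have hFc : Continuous (𝓕 u) := Literature.Analysis.Fourier.continuous_fourier_real hu.integrable
  have hFb : ∀ ξ, ‖𝓕 u ξ‖ ≤ ∫ t, ‖u t‖ := fun ξ =>
    VectorFourier.norm_fourierIntegral_le_integral_norm _ _ _ _ _
  have hGi : Integrable (𝓕⁻ φ) := integrable_fourierInv_of_isWeilTest (isWeilTest_phiCut a)
  have hFGi : Integrable fun ξ => 𝓕 u ξ * 𝓕⁻ φ ξ :=
    hGi.bdd_mul hFc.aestronglyMeasurable (ae_of_all _ hFb)
  refine ⟨hFGi, ?_⟩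
  rw [integral_add_compl hs hFGi]
  have e : (fun t => u t * conj (φ t)) = fun t => u t * φ t := by
    funext t
    rw [hφdef]
    simp only [conj_phiCut]
  rw [e]
  exact integral_mul_eq_integral_fourier_mul_fourierInv hu.integrable (isWeilTest_phiCut a)

/-- **Tail estimate** (uniform in the window): for a ground state `u` at `a ≥ 1`, a measurable
frequency set `s` and `θ > 0`,
`‖∫_{sᶜ} 𝓕u · 𝓕⁻φ_a‖ ≤ θ/2 + (1/2θ)(2∫_{sᶜ}|ξ(1/2+2πi·)|² + 2π(Dη(a))²)`
(AM–GM, Plancherel `∫|𝓕u|² = ∫|u|² = 1`, and the `L²`-tail of `𝓕⁻φ_a`). [folklore] -/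
theorem exists_norm_tail_fourier_overlap_le :
    ∃ D : ℝ, 0 ≤ D ∧ ∀ a : ℝ, 1 ≤ a → ∀ u : ℝ → ℂ, IsWeilGroundState a u →
      ∀ s : Set ℝ, MeasurableSet s → ∀ θ : ℝ, 0 < θ →
        ‖∫ ξ in sᶜ, 𝓕 u ξ * 𝓕⁻ (fun t : ℝ => (2 : ℂ) * LagariasMontague.Psic (2 * t) *
            ((Literature.Analysis.Calculus.cutoff a t : ℝ) : ℂ)) ξ‖ ≤
          θ / 2 + 1 / (2 * θ) * (2 * (∫ ξ in sᶜ, ‖riemannXi (1 / 2 + ((2 * π * ξ : ℝ) : ℂ) * I)‖ ^ 2) +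
            2 * π * (D * Real.exp (-(π / 4 * Real.exp (2 * (a - 1))))) ^ 2) := by
  obtain ⟨D, hD0, hD⟩ := exists_setIntegral_norm_sq_fourierInv_phiCut_le
  refine ⟨D, hD0, fun a ha u hu s hs θ hθ => ?_⟩
  obtain ⟨hG2i, -, hGtail⟩ := hD a ha
  have hF2 : ∫ ξ, ‖𝓕 u ξ‖ ^ 2 = 1 := by
    rw [Literature.Analysis.FunctionSpaces.integral_norm_sq_fourierIntegral_eq hu.integrable
      hu.memLp, hu.integral_norm_sq]
  have hF2i : Integrable fun ξ => ‖𝓕 u ξ‖ ^ 2 := by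
    have h := Literature.Analysis.FunctionSpaces.memLp_two_fourierIntegral hu.integrable hu.memLp
    exact (memLp_two_iff_integrable_sq_norm h.1).1 h
  have h1 := norm_setIntegral_mul_le_of_sq (s := sᶜ) hF2i hG2i.integrableOn hθ
  rw [hF2, mul_one] at h1
  exact h1.trans (by
    have hθ' : 0 ≤ 1 / (2 * θ) := by positivity
    have := mul_le_mul_of_nonneg_left (hGtail s hs) hθ'
    linarith)

/-- **Bulk estimate**: there is `E ≥ 0` such that for every ground state `u` at `a ≥ 1`, every
scalar `c`, every frequency window `[-R, R]` and every `ε ≥ 0` with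
`sup_{|ξ|≤R} ‖c 𝓕u(ξ) − ξ(1/2+2πiξ)‖ ≤ ε`,
`‖c ∫_{[-R,R]} 𝓕u·𝓕⁻φ_a − ∫_{[-R,R]} |ξ(1/2+2πi·)|²‖ ≤ 2R·E·(ε + η(a))`
(`c𝓕u·𝓕⁻φ_a − Ξ·Ξ = (c𝓕u − Ξ)𝓕⁻φ_a + Ξ(𝓕⁻φ_a − Ξ)`, `|Ξ| ≤ C_Ψ`, `|𝓕⁻φ_a| ≤ C_Ψ + D`,
`|𝓕⁻φ_a − Ξ| ≤ D'η(a)`, and `Ξ² = |Ξ|²` on the line). [folklore] -/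
theorem exists_norm_bulk_fourier_overlap_sub_le :
    ∃ E : ℝ, 0 ≤ E ∧ ∀ a : ℝ, 1 ≤ a → ∀ u : ℝ → ℂ, IsWeilGroundState a u → ∀ c : ℂ,
      ∀ R : ℝ, 0 ≤ R → ∀ ε : ℝ, 0 ≤ ε →
        (∀ ξ ∈ Icc (-R) R, ‖c * 𝓕 u ξ - riemannXi (1 / 2 + ((2 * π * ξ : ℝ) : ℂ) * I)‖ ≤ ε) →
        ‖c * (∫ ξ in Icc (-R) R, 𝓕 u ξ * 𝓕⁻ (fun t : ℝ => (2 : ℂ) * LagariasMontague.Psic (2 * t) *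
            ((Literature.Analysis.Calculus.cutoff a t : ℝ) : ℂ)) ξ) -
          ((∫ ξ in Icc (-R) R, ‖riemannXi (1 / 2 + ((2 * π * ξ : ℝ) : ℂ) * I)‖ ^ 2 : ℝ) : ℂ)‖ ≤
          2 * R * ((LagariasMontague.fourierDecayConst + 1) *
            (ε + Real.exp (-(π / 4 * Real.exp (2 * (a - 1)))))) * (E + 1) := by
  obtain ⟨D, hD0, hD⟩ := exists_setIntegral_norm_sq_fourierInv_phiCut_le
  obtain ⟨D', hD'0, hD'⟩ := exists_norm_fourierInv_phiCut_sub_le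
  obtain ⟨hgi, -, -⟩ := integral_norm_sq_riemannXi_eq_and_pos
  set B : ℝ := LagariasMontague.fourierDecayConst with hBdef
  have hB0 : 0 ≤ B := fourierDecayConst_nonneg
  refine ⟨D + D', by positivity, fun a ha u hu c R hR ε hε hbulk => ?_⟩
  set φ : ℝ → ℂ := fun t : ℝ => (2 : ℂ) * LagariasMontague.Psic (2 * t) *
    ((Literature.Analysis.Calculus.cutoff a t : ℝ) : ℂ) with hφdef
  set Xi : ℝ → ℂ := fun ξ => riemannXi (1 / 2 + ((2 * π * ξ : ℝ) : ℂ) * I) with hXidef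
  set η : ℝ := Real.exp (-(π / 4 * Real.exp (2 * (a - 1)))) with hηdef
  have hη0 : 0 ≤ η := (Real.exp_pos _).le
  obtain ⟨-, hGsup, -⟩ := hD a ha
  have hGsup' : ∀ ξ, ‖𝓕⁻ φ ξ‖ ≤ B + D := hGsup
  have hsub' : ∀ ξ, ‖𝓕⁻ φ ξ - Xi ξ‖ ≤ D' * η := by
    intro ξ
    refine (hD' a ha ξ).trans ?_
    rw [div_le_iff₀ (by positivity)]
    have h1 : 0 ≤ D' * η := by positivity
    nlinarith [sq_nonneg (2 * π * ξ)]
  have hFGi := (overlap_eq_bulk_add_tail hu (measurableSet_Icc (a := -R) (b := R))).1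
  have hbulkpt : ∀ ξ ∈ Icc (-R) R, ‖c * (𝓕 u ξ * 𝓕⁻ φ ξ) - ((‖Xi ξ‖ ^ 2 : ℝ) : ℂ)‖ ≤
      (B + 1) * (ε + η) * (D + D' + 1) := by
    intro ξ hξ
    have e1 : ((‖Xi ξ‖ ^ 2 : ℝ) : ℂ) = Xi ξ * Xi ξ := by
      rw [hXidef]
      exact (riemannXi_criticalLine_mul_self _).symm
    have e2 : c * (𝓕 u ξ * 𝓕⁻ φ ξ) - Xi ξ * Xi ξ =
        (c * 𝓕 u ξ - Xi ξ) * 𝓕⁻ φ ξ + Xi ξ * (𝓕⁻ φ ξ - Xi ξ) := by ring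
    rw [e1, e2]
    have hb1 : ‖c * 𝓕 u ξ - Xi ξ‖ ≤ ε := hbulk ξ hξ
    have hb2 : ‖𝓕⁻ φ ξ‖ ≤ B + D := hGsup' ξ
    have hb3 : ‖Xi ξ‖ ≤ B := norm_riemannXi_criticalLine_le _
    have hb4 : ‖𝓕⁻ φ ξ - Xi ξ‖ ≤ D' * η := hsub' ξ
    calc ‖(c * 𝓕 u ξ - Xi ξ) * 𝓕⁻ φ ξ + Xi ξ * (𝓕⁻ φ ξ - Xi ξ)‖
        ≤ ‖c * 𝓕 u ξ - Xi ξ‖ * ‖𝓕⁻ φ ξ‖ + ‖Xi ξ‖ * ‖𝓕⁻ φ ξ - Xi ξ‖ := by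
          refine (norm_add_le _ _).trans (le_of_eq ?_)
          rw [norm_mul, norm_mul]
      _ ≤ ε * (B + D) + B * (D' * η) :=
          add_le_add (mul_le_mul hb1 hb2 (norm_nonneg _) hε)
            (mul_le_mul hb3 hb4 (norm_nonneg _) hB0)
      _ ≤ (B + 1) * (ε + η) * (D + D' + 1) := by
          have h1 : 0 ≤ ε * η := by positivity
          have h2 : 0 ≤ B * ε := by positivity
          nlinarith [mul_nonneg hB0 hD0, mul_nonneg hB0 hD'0, mul_nonneg hε hD'0,
            mul_nonneg hη0 hD0, mul_nonneg (mul_nonneg hB0 hε) hD'0,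
            mul_nonneg (mul_nonneg hB0 hη0) hD0]
  rw [← integral_const_mul, ← integral_complex_ofReal]
  refine (norm_setIntegral_Icc_sub_le hR (hFGi.const_mul _).integrableOn
    hgi.ofReal.integrableOn hbulkpt).trans (le_of_eq ?_)
  ring

/-! ## The overlap with the window's kernel stays non-degenerate when `c_k` is bounded -/

set_option maxHeartbeats 400000 in
/-- **Core estimate (RH-free).**  Let `u_k` be ground states at windows `a_k → ∞` and `c_k`
scalars with `c_k û_k → ξ` locally uniformly on the open strip.  For every `M > 0` there is
`L > 0` such that, for all large `k` with `‖c_k‖ ≤ M`, the overlap with the window's own truncated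
Riemann kernel is non-degenerate: `‖⟨u_k, φ_{a_k}⟩‖ ≥ L`.
Proof: `⟨u_k, φ_{a_k}⟩ = ∫ 𝓕u_k · 𝓕⁻φ_{a_k}` (Parseval); on a frequency window `[-R, R]`,
`c_k 𝓕u_k → Ξ` uniformly (the crux hypothesis on a compact piece of the critical line) and
`𝓕⁻φ_{a_k} → Ξ` uniformly, so `c_k · bulk ≈ ∫_{[-R,R]} |Ξ|² ≥ (3/4)‖Ξ‖²_{L²}`; off the window,
AM–GM with Plancherel `∫|𝓕u_k|² = ∫|u_k|² = 1` (window-INDEPENDENT) and the uniform `L²`-tail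
of `𝓕⁻φ_a` make `‖c_k‖ · |tail|` small when `‖c_k‖ ≤ M`.  Hence
`‖c_k‖·‖⟨u_k, φ_{a_k}⟩‖ ≥ ‖Ξ‖²_{L²}/2`. -/
theorem exists_eventually_norm_overlap_ge {a : ℕ → ℝ} {u : ℕ → ℝ → ℂ} {c : ℕ → ℂ}
    (ha : Tendsto a atTop atTop) (hu : ∀ k, IsWeilGroundState (a k) (u k))
    (hlim : TendstoLocallyUniformlyOn (fun k s => c k * weilMellin (u k) s) riemannXi atTop
      {s : ℂ | 0 < s.re ∧ s.re < 1}) {M : ℝ} (hM : 0 < M) :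
    ∃ L : ℝ, 0 < L ∧ ∀ᶠ k in atTop, ‖c k‖ ≤ M →
      L ≤ ‖∫ t, u k t * conj ((2 : ℂ) * LagariasMontague.Psic (2 * t) *
        ((Literature.Analysis.Calculus.cutoff (a k) t : ℝ) : ℂ))‖ := by
  -- notation and constants
  set φ : ℝ → ℝ → ℂ := fun A t => (2 : ℂ) * LagariasMontague.Psic (2 * t) *
    ((Literature.Analysis.Calculus.cutoff A t : ℝ) : ℂ) with hφdef
  set g : ℝ → ℝ := fun ξ => ‖riemannXi (1 / 2 + ((2 * π * ξ : ℝ) : ℂ) * I)‖ ^ 2 with hgdef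
  set η : ℝ → ℝ := fun A => Real.exp (-(π / 4 * Real.exp (2 * (A - 1)))) with hηdef
  set B₁ : ℝ := LagariasMontague.fourierDecayConst + 1 with hB₁def
  have hB₁ : 0 < B₁ := by
    have := fourierDecayConst_nonneg; rw [hB₁def]; linarith
  obtain ⟨hgi, -, hJpos⟩ := integral_norm_sq_riemannXi_eq_and_pos
  set J : ℝ := ∫ ξ, g ξ with hJdef
  obtain ⟨D, hD0, hD⟩ := exists_norm_tail_fourier_overlap_le
  obtain ⟨E, hE0, hE⟩ := exists_norm_bulk_fourier_overlap_sub_le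
  have hη0 : ∀ A, 0 < η A := fun A => Real.exp_pos _
  have hη1 : ∀ A, η A ≤ 1 := fun A => by
    rw [hηdef]
    exact Real.exp_le_one_iff.2 (by
      have := Real.exp_pos (2 * (A - 1)); nlinarith [Real.pi_gt_three])
  set θ : ℝ := J / (8 * M) with hθdef
  have hθ0 : 0 < θ := by positivity
  set δ₁ : ℝ := min (J ^ 2 / (128 * M ^ 2)) (J / 4) with hδ₁def
  have hδ₁0 : 0 < δ₁ := by positivity
  -- tails of `g`: pick `R ≥ 1` with `∫_{[-R,R]ᶜ} g ≤ δ₁`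
  have hcompl : ∀ n : ℕ, ∫ ξ in (Icc (-(n : ℝ)) n)ᶜ, g ξ = J - ∫ ξ in Icc (-(n : ℝ)) n, g ξ := by
    intro n
    have := integral_add_compl (measurableSet_Icc (a := -(n : ℝ)) (b := n)) hgi
    rw [hJdef]; linarith
  have htail : Tendsto (fun n : ℕ => ∫ ξ in (Icc (-(n : ℝ)) n)ᶜ, g ξ) atTop (𝓝 0) := by
    have hmono : Monotone fun n : ℕ => Icc (-(n : ℝ)) n := by
      intro m n hmn
      have h : (m : ℝ) ≤ n := by exact_mod_cast hmn
      exact Icc_subset_Icc (by linarith) h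
    have hU : (⋃ n : ℕ, Icc (-(n : ℝ)) n) = univ := by
      refine eq_univ_of_forall fun x => ?_
      obtain ⟨n, hn⟩ := exists_nat_ge |x|
      exact mem_iUnion.2 ⟨n, abs_le.1 hn⟩
    have h1 := tendsto_setIntegral_of_monotone (μ := volume) (f := g)
      (fun n : ℕ => (measurableSet_Icc : MeasurableSet (Icc (-(n : ℝ)) n))) hmono
      (by rw [hU]; exact hgi.integrableOn)
    rw [hU, setIntegral_univ] at h1
    have h2 := (tendsto_const_nhds (x := J)).sub h1
    rw [← hJdef, sub_self] at h2
    refine h2.congr fun n => ?_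
    rw [hcompl n]
  obtain ⟨R, hRtail, hR1⟩ := ((htail.eventually (ge_mem_nhds hδ₁0)).and
    (eventually_ge_atTop 1)).exists
  have hR0 : (0 : ℝ) ≤ R := by positivity
  set S : Set ℝ := Icc (-(R : ℝ)) R with hSdef
  have hS : MeasurableSet S := measurableSet_Icc
  -- the small parameters in `k`
  set ε₁ : ℝ := J / (64 * R * B₁ * (E + 1)) with hε₁def
  have hε₁0 : 0 < ε₁ := by positivity
  set ε₂ : ℝ := min ε₁ (J ^ 2 / (128 * M ^ 2 * (π * D ^ 2 + 1))) with hε₂def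
  have hε₂0 : 0 < ε₂ := by positivity
  have hηa : Tendsto (fun k => η (a k)) atTop (𝓝 0) := tendsto_superexp_zero.comp ha
  refine ⟨J / (2 * M), by positivity, ?_⟩
  filter_upwards [ha.eventually (eventually_ge_atTop (1 : ℝ)),
    eventually_norm_fourier_sub_riemannXi_lt hlim R hε₁0,
    hηa.eventually (ge_mem_nhds hε₂0)] with k hak hbulk hηk hcM
  have hηk0 := hη0 (a k)
  have hηk1 := hη1 (a k)
  -- splitting, tail, bulk at step `k`
  obtain ⟨-, hP⟩ := overlap_eq_bulk_add_tail (hu k) hS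
  have hT := hD (a k) hak (u k) (hu k) S hS θ hθ0
  have hBu := hE (a k) hak (u k) (hu k) (c k) R hR0 ε₁ hε₁0.le (fun ξ hξ => (hbulk ξ hξ).le)
  set bulk : ℂ := ∫ ξ in S, 𝓕 (u k) ξ * 𝓕⁻ (φ (a k)) ξ with hbulkdef
  set tail : ℂ := ∫ ξ in Sᶜ, 𝓕 (u k) ξ * 𝓕⁻ (φ (a k)) ξ with htaildef
  have hP' : (∫ t, u k t * conj (φ (a k) t)) = bulk + tail := hP
  have hT' : ‖tail‖ ≤ θ / 2 + 1 / (2 * θ) * (2 * (∫ ξ in Sᶜ, g ξ) + 2 * π * (D * η (a k)) ^ 2) := hT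
  have hBu' : ‖c k * bulk - ((∫ ξ in S, g ξ : ℝ) : ℂ)‖ ≤ 2 * R * (B₁ * (ε₁ + η (a k))) * (E + 1) := hBu
  -- (1) the tail is small: `M ‖tail‖ ≤ 3J/16`
  have htail_le : M * ‖tail‖ ≤ 3 * J / 16 := by
    have h3 : (D * η (a k)) ^ 2 ≤ D ^ 2 * η (a k) := by
      rw [mul_pow]
      refine mul_le_mul_of_nonneg_left ?_ (by positivity)
      nlinarith
    have hRt : ∫ ξ in Sᶜ, g ξ ≤ δ₁ := hRtail
    have h4 : ‖tail‖ ≤ θ / 2 + δ₁ / θ + π * D ^ 2 * η (a k) / θ := by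
      refine hT'.trans ?_
      have hθ' : 0 ≤ 1 / (2 * θ) := by positivity
      have h5 : 2 * (∫ ξ in Sᶜ, g ξ) + 2 * π * (D * η (a k)) ^ 2 ≤
          2 * δ₁ + 2 * π * (D ^ 2 * η (a k)) := by nlinarith [Real.pi_pos]
      have h6 := mul_le_mul_of_nonneg_left h5 hθ'
      have e : 1 / (2 * θ) * (2 * δ₁ + 2 * π * (D ^ 2 * η (a k))) =
          δ₁ / θ + π * D ^ 2 * η (a k) / θ := by
        field_simp
      linarith
    have hm1 : M * (θ / 2) = J / 16 := by
      rw [hθdef]; field_simp; ring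
    have hm2 : M * (δ₁ / θ) ≤ J / 16 := by
      have hδ : δ₁ ≤ J ^ 2 / (128 * M ^ 2) := min_le_left _ _
      rw [le_div_iff₀ (by positivity)] at hδ
      have e : M * (δ₁ / θ) = 8 * M ^ 2 * δ₁ / J := by
        rw [hθdef]; field_simp
      rw [e, div_le_div_iff₀ hJpos (by norm_num : (0 : ℝ) < 16)]
      linarith [hδ]
    have hm3 : M * (π * D ^ 2 * η (a k) / θ) ≤ J / 16 := by
      have hη2 : η (a k) ≤ J ^ 2 / (128 * M ^ 2 * (π * D ^ 2 + 1)) :=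
        hηk.trans (min_le_right _ _)
      rw [le_div_iff₀ (by positivity)] at hη2
      have e : M * (π * D ^ 2 * η (a k) / θ) = 8 * M ^ 2 * π * D ^ 2 * η (a k) / J := by
        rw [hθdef]; field_simp
      rw [e, div_le_div_iff₀ hJpos (by norm_num : (0 : ℝ) < 16)]
      have h4 : 0 ≤ M ^ 2 * η (a k) := by positivity
      linarith [hη2, h4]
    have h7 := mul_le_mul_of_nonneg_left h4 hM.le
    rw [mul_add, mul_add, hm1] at h7
    linarith
  -- (2) the bulk is large: `‖c_k bulk‖ ≥ 11J/16`
  have hbulk_ge : 11 * J / 16 ≤ ‖c k * bulk‖ := by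
    have hgS : 3 * J / 4 ≤ ∫ ξ in S, g ξ := by
      have h1 := hcompl R
      have h2 : δ₁ ≤ J / 4 := min_le_right _ _
      have h3 : ∫ ξ in Sᶜ, g ξ ≤ δ₁ := hRtail
      rw [hSdef]
      linarith
    have hsmall : 2 * R * (B₁ * (ε₁ + η (a k))) * (E + 1) ≤ J / 16 := by
      have hη2 : η (a k) ≤ ε₁ := hηk.trans (min_le_left _ _)
      have h1 : 2 * R * (B₁ * (ε₁ + η (a k))) * (E + 1) ≤ 2 * R * (B₁ * (ε₁ + ε₁)) * (E + 1) := by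
        gcongr
      have e : 2 * R * (B₁ * (ε₁ + ε₁)) * (E + 1) = J / 16 := by
        rw [hε₁def]; field_simp; ring
      linarith
    have h1 : ‖((∫ ξ in S, g ξ : ℝ) : ℂ)‖ = ∫ ξ in S, g ξ := by
      rw [Complex.norm_real, Real.norm_eq_abs,
        abs_of_nonneg (setIntegral_nonneg hS fun _ _ => by positivity)]
    have h2 := norm_sub_norm_le (((∫ ξ in S, g ξ : ℝ) : ℂ)) (c k * bulk)
    rw [norm_sub_rev] at hBu'
    linarith
  -- (3) combine
  have hkey : J / 2 ≤ ‖c k‖ * ‖∫ t, u k t * conj (φ (a k) t)‖ := by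
    rw [← norm_mul, hP', mul_add]
    have h1 : ‖c k * bulk‖ ≤ ‖c k * bulk + c k * tail‖ + ‖c k * tail‖ := by
      have := norm_add_le (c k * bulk + c k * tail) (-(c k * tail))
      rwa [add_neg_cancel_right, norm_neg] at this
    have h2 : ‖c k * tail‖ ≤ M * ‖tail‖ := by
      rw [norm_mul]
      exact mul_le_mul_of_nonneg_right hcM (norm_nonneg _)
    linarith
  have hfin : J / 2 ≤ M * ‖∫ t, u k t * conj (φ (a k) t)‖ :=
    hkey.trans (mul_le_mul_of_nonneg_right hcM (norm_nonneg _))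
  rw [div_le_iff₀ (by positivity)]
  nlinarith [hfin]

end Summit.RiemannHypothesis.RiemannHypothesis.Theorems.GroundStatesConvergeToXi

end
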